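import Literature.Probability.Percolation.IntSurgery
import Literature.Probability.Percolation.IntTipBoxes
import Literature.Probability.Percolation.AdjArmsFrame
import HarnessLib

/-!
# The two inner exits of one colour from its two actual arms (twin of `AdjPairBuild.lean`)

Topic `Literature/Probability/Percolation`; family `crit-perc` / near-critical percolation on `𝕋`.
A brick of the INNER half of the near-critical arm-separation theorem for four arms in the ADJACENT
colour arrangement (P. Nolin, EJP 13 (2008), Thm. 11, `j = 4`, `σ = BBWW` [arXiv 0711.4948:
Thm. 10], §4.4 Lemma 15 and Thm. 11, internal extremities). From the two disjoint clean actual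
arms of one colour — far ends beyond `Λ_{2m}` (on the outer free-space crossings), first visits of
`∂Λ_m` at `ρ^{i q}(m, t q)` — and the good event of the frames of their sides, the two inner exits
of that colour: a pair structure `IntPairData` when the sides coincide, a cross structure
`IntCrossData` (two `IntPairDataB`, rotations `ρ^{i 0}`, `ρ^{i 1}`, `rot_intTipBox_ne`) otherwise,
then `IntPairData.exists_exits_prov` / `IntCrossData.exists_exits_of_rot_prov`.

* `IntFrameGood m k₀ K T T' R₁ R₂ χ` — the good event of one frame: both explorations stop before
  `T`, `T'` and have no raw failure, and the two CORNER GUARDS (closed frames at scales `R₁`, `R₂`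
  about the ends `(m, -m)`, `(m, 0)` of the side);
* `int_far_end_low`, `int_frameWalk_supp`, `int_frameWalk_clean`, `int_frame_end`,
  `arm_end_low_of_guard`, `arm_end_high_of_guard` (middle arm ends from the guards);
* `int_colour_exits`.

Everything here is proved; no named facts are introduced.

## References

* P. Nolin, Near-critical percolation in two dimensions, *Electron. J. Probab.* 13 (2008), §4.2
  Def. 6–8, §4.4 Lemma 15 and Thm. 11 (proof), internal extremities (arXiv 0711.4948: Def. 6–8,
  Lemma 14, Thm. 10) [Nolin2008].
-/

noncomputable section

open Set

namespace Literature.Probability.Percolation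

open LatticeModels SimpleGraph HalfAnnulus
open IntPairData (term_isCrossing term_eq tip_isIntJ' term_open term_norm)

/-- **The good event of one inner frame** for the configuration `χ` (already read in the frame):
the exploration of `intDom m` from below has fewer than `T` terms and none fails rawly, the same
from above with `T'`, and the two corner guards: the closed sites of `χ` contain the frames at the
scales `R₁`, `R₂` about the two ends of the inner side. [cite: Nolin2008, §4.4 Lemma 15 and Thm. 11 (proof), internal extremities (arXiv 0711.4948: Lemma 14, Thm. 10)] -/
def IntFrameGood (m k₀ K T T' R₁ R₂ : ℕ) (χ : SiteConfig (Site 2)) : Prop :=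
  (intDom m).lowestSeq χ T = none ∧ (∀ u < T, ¬ IntSeqFailRaw m u k₀ K χ) ∧
  (intDom m).flip.lowestSeq χ T' = none ∧ (∀ u < T', ¬ IntSeqFailRawUp m u k₀ K χ) ∧
  χᶜ ∈ triFrameAt ![(m : ℤ), -(m : ℤ)] R₁ ∧ χᶜ ∈ triFrameAt ![(m : ℤ), 0] R₂

/-- The far end read in another frame is below the fence zones: `(ρ^d (m, t))₀ + 3k < m` for
`d ≠ 0` and a middle `t`. [folklore] -/
theorem int_far_end_low {m k : ℕ} {t : ℤ} (ht : -(m : ℤ) + 8 * k < t ∧ t + 8 * k < 0) {d : ℕ} (hd : d < 6) (hd0 : d ≠ 0) :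
    (triRotIsoPow d ![(m : ℤ), t]) 0 + 3 * (k : ℤ) < m := by
  obtain ⟨-, -, a0, -, b0, -, c0, -, d0, -, e0, -⟩ := rot_apply_formula (![(m : ℤ), t] : Site 2)
  have e0' : (![(m : ℤ), t] : Site 2) 0 = m := rfl
  have e1' : (![(m : ℤ), t] : Site 2) 1 = t := rfl
  interval_cases d
  · exact absurd rfl hd0
  · rw [a0, e1']; omega
  · rw [b0, e0', e1']; omega
  · rw [c0, e0']; omega
  · rw [d0, e1']; omega
  · rw [e0, e0', e1']; omega

/-- Sites of a frame reading lie in the annulus region and are open in the frame configuration. [folklore] -/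
theorem int_frameWalk_supp {m N' i : ℕ} (hi : i ≤ 6) {χ : SiteConfig (Site 2)} {x y : Site 2} {W : triGraph.Walk x y}
    (hsupp : ∀ v ∈ W.support, (m : ℤ) ≤ triNorm v ∧ triNorm v ≤ N') (hopen : ∀ v ∈ W.support, v ∈ χ) :
    ∀ v ∈ (frameWalk i W).support, ((m : ℤ) ≤ triNorm v ∧ triNorm v ≤ N') ∧ v ∈ (rotConfig i χ : Set (Site 2)) := by
  intro v hv
  obtain ⟨u, hu, rfl⟩ := mem_support_frameWalk.1 hv
  refine ⟨by rw [triNorm_rot]; exact hsupp u hu, ?_⟩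
  show triRotIsoPow (6 - i) u ∈ rotConfig i χ
  rw [mem_rotConfig, ← triRotIsoPow_add_apply, show 6 - i + i = 6 by omega, triRotIsoPow_six_apply]
  exact hopen u hu

/-- Cleanness of the frame reading at `∂Λ_m`. [folklore] -/
theorem int_frameWalk_clean {m i : ℕ} {x y : Site 2} {W : triGraph.Walk x y} (hclean : ∀ v ∈ W.support, triNorm v = m → v = y) :
    ∀ v ∈ (frameWalk i W).support, triNorm v = m → v = triRotIsoPow (6 - i) y := by
  intro v hv hvn
  obtain ⟨u, hu, rfl⟩ := mem_support_frameWalk.1 hv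
  rw [triNorm_rot] at hvn
  rw [hclean u hu hvn]

/-- The frame reading of the end `ρ^i (m, t)` is `(m, t)`. [folklore] -/
theorem int_frame_end {m i : ℕ} (hi : i ≤ 6) {t : ℤ} {y : Site 2} (hy : y = triRotIsoPow i ![(m : ℤ), t]) :
    triRotIsoPow (6 - i) y = ![(m : ℤ), t] := by
  rw [hy, ← triRotIsoPow_add_apply, show i + (6 - i) = 6 by omega, triRotIsoPow_six_apply]

/-- **The lower corner guard keeps open arm ends away from the lower corner**: an open path from a
site beyond the `2R`-box about `(m, -m)` cannot end at `(m, t)` with `t < -m + R` (it would meet the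
closed frame). [cite: Nolin2008, §4.4 Thm. 11 (proof, internal extremities) (arXiv 0711.4948: Thm. 10)] -/
theorem arm_end_low_of_guard {m R : ℕ} (hR : 1 ≤ R) {χ : SiteConfig (Site 2)} (hfr : χᶜ ∈ triFrameAt ![(m : ℤ), -(m : ℤ)] R)
    {A : Set (Site 2)} (hA : A ⊆ χ) {b : Site 2} (hb : 2 * (m : ℤ) < triNorm b) (h4 : 4 * (R : ℤ) < m) {t : ℤ}
    (hP : PathIn triGraph A b ![(m : ℤ), t]) (htm : -(m : ℤ) ≤ t) : -(m : ℤ) + R ≤ t := by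
  by_contra hlt
  rw [not_le] at hlt
  obtain ⟨F⟩ := nonempty_frameData hfr
  have hbout : b 0 ≤ (m : ℤ) - 2 * R ∨ (m : ℤ) + 2 * R ≤ b 0 ∨ b 1 ≤ -(m : ℤ) - 2 * R ∨ -(m : ℤ) + 2 * R ≤ b 1 := by
    by_contra h
    push Not at h
    have : triNorm b ≤ 2 * (m : ℤ) := triNorm_le_iff_lin.2 (by omega)
    omega
  obtain ⟨v, hvA, hvK⟩ := F.exists_mem_K hR (s := ![(m : ℤ), t]) (t := b)
    (by simp only [Matrix.cons_val_zero, Matrix.cons_val_one, Matrix.cons_val_fin_one]; omega)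
    (by simp only [Matrix.cons_val_zero, Matrix.cons_val_one, Matrix.cons_val_fin_one]; omega) hP.symm
  exact F.K_subset hvK (hA hvA)

/-- **The upper corner guard keeps open arm ends away from the upper corner.** [cite: Nolin2008, §4.4 Thm. 11 (proof, internal extremities) (arXiv 0711.4948: Thm. 10)] -/
theorem arm_end_high_of_guard {m R : ℕ} (hR : 1 ≤ R) {χ : SiteConfig (Site 2)} (hfr : χᶜ ∈ triFrameAt ![(m : ℤ), 0] R)
    {A : Set (Site 2)} (hA : A ⊆ χ) {b : Site 2} (hb : 2 * (m : ℤ) < triNorm b) (h4 : 4 * (R : ℤ) < m) {t : ℤ}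
    (hP : PathIn triGraph A b ![(m : ℤ), t]) (ht0 : t ≤ 0) : t ≤ -(R : ℤ) := by
  by_contra hlt
  rw [not_le] at hlt
  obtain ⟨F⟩ := nonempty_frameData hfr
  have hbout : b 0 ≤ (m : ℤ) - 2 * R ∨ (m : ℤ) + 2 * R ≤ b 0 ∨ b 1 ≤ 0 - 2 * R ∨ 0 + 2 * R ≤ b 1 := by
    by_contra h
    push Not at h
    have : triNorm b ≤ 2 * (m : ℤ) := triNorm_le_iff_lin.2 (by omega)
    omega
  obtain ⟨v, hvA, hvK⟩ := F.exists_mem_K hR (s := ![(m : ℤ), t]) (t := b)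
    (by simp only [Matrix.cons_val_zero, Matrix.cons_val_one, Matrix.cons_val_fin_one]; omega)
    (by simp only [Matrix.cons_val_zero, Matrix.cons_val_one, Matrix.cons_val_fin_one]; omega) hP.symm
  exact F.K_subset hvK (hA hvA)

namespace IntExit

variable {m k₀ K : ℕ} {A : Set (Site 2)} {χ χ' : SiteConfig (Site 2)}

/-- An inner exit of a configuration is an inner exit of every larger configuration. [folklore] -/
def mapMono (F : IntExit m A k₀ K χ) (h : χ ≤ χ') : IntExit m A k₀ K χ' where
  z := F.z
  j := F.j
  m' := F.m'
  b := F.b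
  z_isIntJ := F.z_isIntJ
  j_lt := F.j_lt
  b_far := F.b_far
  vcross := by
    obtain ⟨b, t, hb, ht, Pb, Pt⟩ := F.vcross
    exact ⟨b, t, hb, ht, Pb.mono fun v hv => ⟨hv.1, h hv.2⟩, Pt.mono fun v hv => ⟨hv.1, h hv.2⟩⟩
  path := F.path.mono fun v hv => ⟨hv.1, h hv.2⟩

/-- Transport of an inner exit along an equality of configurations. [folklore] -/
def transport (F : IntExit m A k₀ K χ) (h : χ = χ') : IntExit m A k₀ K χ' := F.mapMono h.le

/-- `transport` keeps the tip. [folklore] -/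
@[simp] theorem transport_z (F : IntExit m A k₀ K χ) (h : χ = χ') : (F.transport h).z = F.z := rfl
/-- `transport` keeps the scale. [folklore] -/
@[simp] theorem transport_k (F : IntExit m A k₀ K χ) (h : χ = χ') : (F.transport h).k = F.k := rfl
/-- `transport` keeps the far end. [folklore] -/
@[simp] theorem transport_b (F : IntExit m A k₀ K χ) (h : χ = χ') : (F.transport h).b = F.b := rfl
/-- `transport` keeps the fence site. [folklore] -/
@[simp] theorem transport_m' (F : IntExit m A k₀ K χ) (h : χ = χ') : (F.transport h).m' = F.m' := rfl

end IntExit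

/-- **The two inner exits of one colour from its two actual arms.** Inputs: two disjoint
self-avoiding actual arms `W q : x q ⇝ y q` of sites of norm in `[m, N']`, open in `χ`, clean at
`∂Λ_m` (`|v| = m → v = y q`), far ends `|x q| > 2m`, ends `y q = ρ^{i q} (m, t q)` with
`-m ≤ t q ≤ 0`, and the good events of the frames `i q` with corner guards at scales `R₁, R₂ ≥ R₀`
(`R₀ = 32 κ + 1`, `κ = k_{K-1}`, `4 Rᵢ < m`). Output: one exit behind each of the sides `i 0`,
`i 1`, from the frame readings of the far ends (in some order `r`), with kinds, middle nominal rows,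
protections, clean tight routes, disjoint actual structures, and on a common side both from below
with row-separated tips; and the far provenance of the routes (route sites beyond `Λ_{2m+1}` are
arm sites). [cite: Nolin2008, §4.2 Def. 6–8, §4.4 Lemma 15 and Thm. 11 (proof), internal extremities (arXiv 0711.4948: Def. 6–8, Lemma 14, Thm. 10), σ = BBWW] -/
theorem int_colour_exits {m N' k₀ K T T' R₁ R₂ : ℕ} (hm : 5 ≤ m) (hN : 4 * m ≤ N') (hk₀ : 2 ≤ k₀) (hK : 1 ≤ K)
    (hKm : ∀ j < K, 4 * (16 * trapScale k₀ j) < m)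
    (hR₁ : 32 * trapScale k₀ (K - 1) + 1 ≤ R₁) (hR₂ : 32 * trapScale k₀ (K - 1) + 1 ≤ R₂) (h4R₁ : 4 * R₁ < m) (h4R₂ : 4 * R₂ < m)
    {χ : SiteConfig (Site 2)} {x y : Fin 2 → Site 2} (W : (q : Fin 2) → triGraph.Walk (x q) (y q))
    (hpath : ∀ q, (W q).IsPath) (hfar : ∀ q, 2 * (m : ℤ) < triNorm (x q))
    (hsupp : ∀ q, ∀ v ∈ (W q).support, (m : ℤ) ≤ triNorm v ∧ triNorm v ≤ N') (hopen : ∀ q, ∀ v ∈ (W q).support, v ∈ χ)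
    (hclean : ∀ q, ∀ v ∈ (W q).support, triNorm v = m → v = y q)
    (hdisj : ∀ v ∈ (W 0).support, v ∉ (W 1).support)
    {i : Fin 2 → ℕ} {t : Fin 2 → ℤ} (hi : ∀ q, i q < 6) (hy : ∀ q, y q = triRotIsoPow (i q) ![(m : ℤ), t q])
    (ht : ∀ q, -(m : ℤ) ≤ t q ∧ t q ≤ 0)
    (hgood : ∀ q, IntFrameGood m k₀ K T T' R₁ R₂ (rotConfig (i q) χ)) :
    ∃ (r : Fin 2 → Fin 2) (F : IntExit m (intAnnRegion m N') k₀ K (rotConfig (i 0) χ)) (F' : IntExit m (intAnnRegion m N') k₀ K (rotConfig (i 1) χ))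
      (S S' : Set (Site 2)) (up up' : Bool) (tt tt' : ℤ),
      r 0 ≠ r 1 ∧ F.b = triRotIsoPow (6 - i 0) (x (r 0)) ∧ F'.b = triRotIsoPow (6 - i 1) (x (r 1)) ∧
      F.z 1 = (if up then tt - 3 * (F.k : ℤ) else tt) ∧ F'.z 1 = (if up' then tt' - 3 * (F'.k : ℤ) else tt') ∧
      (-(m : ℤ) + 32 * F.k + 1 ≤ tt ∧ tt ≤ -(32 * (F.k : ℤ) + 1)) ∧ (-(m : ℤ) + 32 * F'.k + 1 ≤ tt' ∧ tt' ≤ -(32 * (F'.k : ℤ) + 1)) ∧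
      IntTipProt m up tt F.k (rotConfig (i 0) χ) ∧ IntTipProt m up' tt' F'.k (rotConfig (i 1) χ) ∧
      PathIn triGraph S F.b F.m' ∧ PathIn triGraph S' F'.b F'.m' ∧
      S ⊆ (intAnnRegion m N' ∪ intExitZone m F.z F.k) ∩ rotConfig (i 0) χ ∧
      S' ⊆ (intAnnRegion m N' ∪ intExitZone m F'.z F'.k) ∩ rotConfig (i 1) χ ∧
      (∀ v ∈ S, triNorm v < m → IntExitTight F.z F.k v) ∧ (∀ v ∈ S', triNorm v < m → IntExitTight F'.z F'.k v) ∧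
      Disjoint (triRotIsoPow (i 0) '' (S ∪ triStrip (F.z 0 - 2 * F.k) (F.z 1 + F.k) F.k F.k))
        (triRotIsoPow (i 1) '' (S' ∪ triStrip (F'.z 0 - 2 * F'.k) (F'.z 1 + F'.k) F'.k F'.k)) ∧
      (i 0 = i 1 → up = false ∧ up' = false ∧ tt ≠ tt' ∧
        (tt < tt' → tt + 17 * F.k < tt') ∧ (tt' < tt → tt' + 17 * F'.k < tt)) ∧
      (∀ v ∈ S, 2 * (m : ℤ) + 1 < triNorm v → triRotIsoPow (i 0) v ∈ (W 0).support ∨ triRotIsoPow (i 0) v ∈ (W 1).support) ∧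
      (∀ v ∈ S', 2 * (m : ℤ) + 1 < triNorm v → triRotIsoPow (i 1) v ∈ (W 0).support ∨ triRotIsoPow (i 1) v ∈ (W 1).support) := by
  set κ := trapScale k₀ (K - 1) with hκ
  set R₀ : ℕ := 32 * κ + 1 with hR₀def
  have hκ1 : 1 ≤ κ := one_le_trapScale (by omega) _
  have hκj : ∀ j < K, trapScale k₀ j ≤ κ := fun j hj => trapScale_mono k₀ (show j ≤ K - 1 by omega)
  have hKR : ∀ j < K, 32 * trapScale k₀ j + 1 ≤ R₀ := fun j hj => by have := hκj j hj; omega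
  have hR₀4 : 4 * R₀ < m := by omega
  have hR₀1 : 1 ≤ R₀ := by omega
  -- the ends are middle, from the guards applied to the frame readings of the arms
  have hend := fun q => int_frame_end (m := m) (hi q).le (hy q)
  have hmidEnd : ∀ q, -(m : ℤ) + R₀ ≤ t q ∧ t q ≤ -(R₀ : ℤ) := by
    intro q
    obtain ⟨-, -, -, -, hg₁, hg₂⟩ := hgood q
    have hP : PathIn triGraph {v | v ∈ (frameWalk (i q) (W q)).support} (triRotIsoPow (6 - i q) (x q)) ![(m : ℤ), t q] := by
      rw [← hend q]
      exact (PathIn.of_walk_mem_support (frameWalk (i q) (W q)) (A := {v | v ∈ (frameWalk (i q) (W q)).support}) (fun v hv => hv)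
        (frameWalk (i q) (W q)).end_mem_support).1
    have hA : {v | v ∈ (frameWalk (i q) (W q)).support} ⊆ (rotConfig (i q) χ : Set (Site 2)) :=
      fun v hv => (int_frameWalk_supp (hi q).le (hsupp q) (hopen q) v hv).2
    have hb : 2 * (m : ℤ) < triNorm (triRotIsoPow (6 - i q) (x q)) := by rw [triNorm_rot]; exact hfar q
    have h1 := arm_end_low_of_guard (by omega) hg₁ hA hb (by omega) hP (ht q).1
    have h2 := arm_end_high_of_guard (by omega) hg₂ hA hb (by omega) hP (ht q).2
    have e1 : (R₁ : ℤ) ≥ R₀ := by exact_mod_cast hR₁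
    have e2 : (R₂ : ℤ) ≥ R₂ := le_rfl
    have e3 : (R₀ : ℤ) ≤ R₂ := by exact_mod_cast hR₂
    constructor <;> omega
  have hyJ : ∀ q, IsIntJ m (triRotIsoPow (6 - i q) (y q)) := fun q => by
    rw [hend q]
    have := hmidEnd q
    exact ⟨rfl, by show -(m : ℤ) + 2 ≤ t q; omega, by show t q ≤ -2; omega⟩
  -- every open crossing of a guarded frame has a middle tip
  have hmidOf : ∀ q (c : Finset (Site 2)) (z : Site 2), (intDom m).IsCrossing c z → (↑c : Set (Site 2)) ⊆ rotConfig (i q) χ → IntMidTip m R₀ z := by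
    intro q c z hc hcω
    obtain ⟨-, -, -, -, hg₁, hg₂⟩ := hgood q
    exact intMidTip_of_guards (by omega) h4R₁ (by omega) h4R₂ hR₀1 hc hcω hg₁ hg₂
  by_cases h01 : i 0 = i 1
  · -- ### the same side: a pair structure
    have eχ : rotConfig (i 0) χ = rotConfig (i 1) χ := by rw [h01]
    let D : IntPairData m N' k₀ K T R₀ (rotConfig (i 0) χ) :=
      { b := fun q => triRotIsoPow (6 - i 0) (x q)
        y := fun q => triRotIsoPow (6 - i 0) (y q)
        A := fun q => frameWalk (i 0) (W q)
        isPath := fun q => frameWalk_isPath (hpath q)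
        supp := fun q => int_frameWalk_supp (hi 0).le (hsupp q) (hopen q)
        b_far := fun q => by rw [triNorm_rot]; exact hfar q
        y_isIntJ := fun q => by
          fin_cases q
          · exact hyJ 0
          · show IsIntJ m (triRotIsoPow (6 - i 0) (y 1)); rw [h01]; exact hyJ 1
        clean := fun q => int_frameWalk_clean (hclean q)
        disj := frameWalk_disjoint hdisj
        stop := (hgood 0).1
        good := (hgood 0).2.1
        mid := fun u c z hu => hmidOf 0 c z (term_isCrossing hu) (term_open hu)
        hm := hm
        hN := hN
        hk₀ := hk₀
        hKm := hKm
        hKR := hKR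
        hR₀ := hR₀4 }
    obtain ⟨u₀, u₁, c₀, c₁, z₀, z₁, hu₀, hu₁, hne, F₀, F₁, S₀, S₁, hFa₀, hFa₁, hFz₀, hFz₁, hFk₀, hFk₁, hP₀, hP₁, hS₀, hS₁, htg₀, htg₁, hdj,
      hpr₀, hpr₁⟩ := D.exists_exits_prov
    -- far provenance: a far route site is an arm site
    have farOf : ∀ {S : Set (Site 2)} {u : ℕ} {c : Finset (Site 2)} {z : Site 2} (hu : (intDom m).lowestSeq (rotConfig (i 0) χ) u = some (c, z)),
        S ⊆ D.Bset ∪ (D.fence hu).F → ∀ v ∈ S, 2 * (m : ℤ) + 1 < triNorm v →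
          triRotIsoPow (i 0) v ∈ (W 0).support ∨ triRotIsoPow (i 0) v ∈ (W 1).support := by
      intro S u c z hu hS v hv hvn
      rcases hS hv with (⟨q, hq⟩ | ⟨u', c', z', hu', hq⟩) | hq
      · have h' := (mem_support_frameWalk_iff (hi 0).le).1 hq
        fin_cases q
        · exact Or.inl h'
        · exact Or.inr h'
      · exact absurd (term_norm hu' (Finset.mem_coe.1 hq)).2 (by omega)
      · have hb := intFenceSet_box ((D.fence hu).F_subset hq)
        obtain ⟨hz0, hz1, hz2⟩ := tip_isIntJ' hu
        have hk := D.kOf_lt hu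
        have := (triNorm_le_iff_lin (x := v) (ρ := 2 * (m : ℤ) + 1)).2 ⟨by omega, by omega, by omega, by omega, by omega, by omega⟩
        exfalso; omega
    have hk₀' : F₀.k = D.kOf hu₀ := hFk₀
    have hk₁' : F₁.k = D.kOf hu₁ := hFk₁
    have hmid₀ := D.tip_midOf hu₀
    have hmid₁ := D.tip_midOf hu₁
    refine ⟨id, F₀, F₁.transport eχ, S₀, S₁, false, false, z₀ 1, z₁ 1, by decide, hFa₀, ?_, by simp [hFz₀], by simp [hFz₁],
      by rw [hk₀']; exact hmid₀, by rw [IntExit.transport_k, hk₁']; exact hmid₁, ?_, ?_, hP₀, ?_, hS₀, ?_, htg₀, ?_, ?_, fun _ => ?_,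
      farOf hu₀ hpr₀, ?_⟩
    · rw [IntExit.transport_b, hFa₁]; show triRotIsoPow (6 - i 0) (x 1) = triRotIsoPow (6 - i 1) (x 1); rw [h01]
    · rw [hk₀']
      exact ⟨c₀, z₀, rfl, tip_isIntJ' hu₀, term_open hu₀, fun _ => ⟨term_isCrossing hu₀, D.raw hu₀⟩, fun h => absurd h (by decide)⟩
    · rw [IntExit.transport_k, hk₁', ← eχ]
      exact ⟨c₁, z₁, rfl, tip_isIntJ' hu₁, term_open hu₁, fun _ => ⟨term_isCrossing hu₁, D.raw hu₁⟩, fun h => absurd h (by decide)⟩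
    · rw [IntExit.transport_b, IntExit.transport_m']; exact hP₁
    · rw [IntExit.transport_z, IntExit.transport_k, ← eχ]; exact hS₁
    · rw [IntExit.transport_z, IntExit.transport_k]; exact htg₁
    · rw [IntExit.transport_z, IntExit.transport_k, ← h01]
      exact (Set.disjoint_image_iff (triRotIsoPow (i 0)).injective).2 hdj
    · refine ⟨rfl, rfl, ?_, fun hlt => ?_, fun hlt => ?_⟩
      · intro he
        rcases Nat.lt_or_gt_of_ne hne with hl | hl
        · exact absurd he (ne_of_lt (D.tip_lt_of_lt hl hu₀ hu₁))
        · exact absurd he.symm (ne_of_lt (D.tip_lt_of_lt hl hu₁ hu₀))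
      · rw [hk₀']
        rcases Nat.lt_or_gt_of_ne hne with hl | hl
        · exact D.row_gap_of_lt hl hu₀ hu₁
        · exact absurd hlt (not_lt.2 (D.tip_lt_of_lt hl hu₁ hu₀).le)
      · rw [IntExit.transport_k, hk₁']
        rcases Nat.lt_or_gt_of_ne hne with hl | hl
        · exact absurd hlt (not_lt.2 (D.tip_lt_of_lt hl hu₀ hu₁).le)
        · exact D.row_gap_of_lt hl hu₁ hu₀
    · rw [← h01]; exact farOf hu₁ hpr₁
  · -- ### two different sides: a cross structure
    have ht8 : ∀ q, -(m : ℤ) + 8 * κ < t q ∧ t q + 8 * κ < 0 := fun q => by have := hmidEnd q; constructor <;> omega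
    -- the far ends are below every fence zone
    have hfarEnd : ∀ q q', i q ≠ i q' → ∀ j < K, (triRotIsoPow (6 - i q) (y q')) 0 + 3 * (trapScale k₀ j : ℤ) < m := by
      intro q q' hqq j hj
      have e : triRotIsoPow (6 - i q) (y q') = triRotIsoPow ((i q' + (6 - i q)) % 6) ![(m : ℤ), t q'] := by
        rw [hy q', ← triRotIsoPow_add_apply, triRotIsoPow_mod_six_apply]
      rw [e]
      have hk := hκj j hj
      refine int_far_end_low (k := trapScale k₀ j) ⟨?_, ?_⟩ (Nat.mod_lt _ (by norm_num)) ?_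
      · have := (ht8 q').1; nlinarith
      · have := (ht8 q').2; nlinarith
      · intro h0; have hi1 := hi q; have hi2 := hi q'; omega
    -- the structure behind the side `i q` with the arm `q` first and the arm `q'` second
    have build : ∀ q q' : Fin 2, q ≠ q' → i q ≠ i q' → ∃ D : IntPairDataB m N' k₀ K T T' R₀ (rotConfig (i q) χ),
        D.b 0 = triRotIsoPow (6 - i q) (x q) ∧ D.b 1 = triRotIsoPow (6 - i q) (x q') ∧
        (∀ v, v ∈ (D.A 0).support ↔ v ∈ (frameWalk (i q) (W q)).support) ∧
        (∀ v, v ∈ (D.A 1).support ↔ v ∈ (frameWalk (i q) (W q')).support) := by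
      intro q q' hqq hiqq
      let σ : Fin 2 → Fin 2 := fun s => if s = 0 then q else q'
      have hσ0 : σ 0 = q := if_pos rfl
      have hσ1 : σ 1 = q' := if_neg (by decide)
      have hdq : ∀ v ∈ (frameWalk (i q) (W (σ 0))).support, v ∉ (frameWalk (i q) (W (σ 1))).support := by
        rw [hσ0, hσ1]
        refine frameWalk_disjoint fun v hv hv' => ?_
        fin_cases q <;> fin_cases q'
        · exact absurd rfl hqq
        · exact hdisj v hv hv'
        · exact hdisj v hv' hv
        · exact absurd rfl hqq
      refine ⟨{ b := fun s => triRotIsoPow (6 - i q) (x (σ s))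
                y := fun s => triRotIsoPow (6 - i q) (y (σ s))
                A := fun s => frameWalk (i q) (W (σ s))
                isPath := fun s => frameWalk_isPath (hpath (σ s))
                supp := fun s => int_frameWalk_supp (hi q).le (hsupp (σ s)) (hopen (σ s))
                b_far := fun s => by rw [triNorm_rot]; exact hfar (σ s)
                y_isIntJ := by show IsIntJ m (triRotIsoPow (6 - i q) (y (σ 0))); rw [hσ0]; exact hyJ q
                yfar := Or.inr (by show ∀ j < K, (triRotIsoPow (6 - i q) (y (σ 1))) 0 + 3 * (trapScale k₀ j : ℤ) < m
                                   rw [hσ1]; exact hfarEnd q q' hiqq)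
                clean := fun s => int_frameWalk_clean (hclean (σ s))
                disj := hdq
                stop := (hgood q).1
                good := (hgood q).2.1
                mid := fun u c z hu => hmidOf q c z (term_isCrossing hu) (term_open hu)
                hm := hm
                hN := hN
                hk₀ := hk₀
                hKm := hKm
                hKR := hKR
                hR₀ := hR₀4
                stopUp := (hgood q).2.2.1
                goodUp := (hgood q).2.2.2.1
                midUp := fun u d z hu => hmidOf q d z (IntPairDataB.termUp_isCrossing hu) (IntPairDataB.termUp_open hu) }, ?_, ?_,
              fun v => ?_, fun v => ?_⟩
      · show triRotIsoPow (6 - i q) (x (σ 0)) = _; rw [hσ0]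
      · show triRotIsoPow (6 - i q) (x (σ 1)) = _; rw [hσ1]
      · show v ∈ (frameWalk (i q) (W (σ 0))).support ↔ _; rw [hσ0]
      · show v ∈ (frameWalk (i q) (W (σ 1))).support ↔ _; rw [hσ1]
    obtain ⟨D₁, hD₁a0, hD₁a1, hD₁A0, hD₁A1⟩ := build 0 1 (by decide) h01
    obtain ⟨D₂, hD₂a0, hD₂a1, hD₂A0, hD₂A1⟩ := build 1 0 (by decide) (Ne.symm h01)
    have hsuppW : ∀ (q : Fin 2) (f : ℕ), f ≤ 6 → ∀ v, v ∈ (frameWalk f (W q)).support ↔ triRotIsoPow f v ∈ (W q).support :=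
      fun q f hf v => mem_support_frameWalk_iff hf
    have fence_far : ∀ x' y' : Site 2,
        ((∃ (u : ℕ) (c : Finset (Site 2)) (z : Site 2) (hu : (intDom m).lowestSeq (rotConfig (i 0) χ) u = some (c, z)), x' ∈ (D₁.fence hu).F) ∨
          (∃ (u : ℕ) (d : Finset (Site 2)) (z : Site 2) (hu : (intDom m).flip.lowestSeq (rotConfig (i 0) χ) u = some (d, z)), x' ∈ (D₁.fenceUp hu).F)) →
        ((∃ (u : ℕ) (c : Finset (Site 2)) (z : Site 2) (hu : (intDom m).lowestSeq (rotConfig (i 1) χ) u = some (c, z)), y' ∈ (D₂.fence hu).F) ∨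
          (∃ (u : ℕ) (d : Finset (Site 2)) (z : Site 2) (hu : (intDom m).flip.lowestSeq (rotConfig (i 1) χ) u = some (d, z)), y' ∈ (D₂.fenceUp hu).F)) →
        triRotIsoPow (i 0) x' ≠ triRotIsoPow (i 1) y' := by
      have boxOf : ∀ (q : Fin 2) (D : IntPairDataB m N' k₀ K T T' R₀ (rotConfig (i q) χ)) (w : Site 2),
          ((∃ (u : ℕ) (c : Finset (Site 2)) (z : Site 2) (hu : (intDom m).lowestSeq (rotConfig (i q) χ) u = some (c, z)), w ∈ (D.fence hu).F) ∨
            (∃ (u : ℕ) (d : Finset (Site 2)) (z : Site 2) (hu : (intDom m).flip.lowestSeq (rotConfig (i q) χ) u = some (d, z)), w ∈ (D.fenceUp hu).F)) →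
          ∃ tq : ℤ, (-(m : ℤ) + 8 * κ ≤ tq ∧ tq ≤ -(8 * (κ : ℤ))) ∧
            ((m : ℤ) - (2 * κ + 1) ≤ w 0 ∧ w 0 ≤ m + (2 * κ + 1) ∧ tq - (2 * κ + 1) ≤ w 1 ∧ w 1 ≤ tq + (2 * κ + 1)) := by
        intro q D w hw
        rcases hw with ⟨u, c, z, hu, hw⟩ | ⟨u, d, z, hu, hw⟩
        · have hb := intFenceSet_box ((D.fence hu).F_subset hw)
          have hmq : IntMidTip m R₀ z := D.mid u c z hu
          unfold IntMidTip at hmq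
          have hz := (tip_isIntJ' hu).1
          have hk : (D.kOf hu : ℤ) ≤ κ := by exact_mod_cast hκj _ (D.jOf_spec hu).1
          have hk1 : (1 : ℤ) ≤ D.kOf hu := by exact_mod_cast D.one_le_kOf hu
          have hR₀' : ((R₀ : ℕ) : ℤ) = 32 * (κ : ℤ) + 1 := by rw [hR₀def]; push_cast; ring
          refine ⟨z 1, ⟨by omega, by omega⟩, ?_, ?_, ?_, ?_⟩ <;> omega
        · have hb := intFenceSetUp_box ((D.fenceUp hu).F_subset hw)
          have hmq : IntMidTip m R₀ z := D.midUp u d z hu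
          unfold IntMidTip at hmq
          have hz := (IntPairDataB.tipUp_isIntJ hu).1
          have hk : (D.kOfUp hu : ℤ) ≤ κ := by exact_mod_cast hκj _ (D.jOfUp_spec hu).1
          have hk1 : (1 : ℤ) ≤ D.kOfUp hu := by exact_mod_cast D.one_le_kOfUp hu
          have hR₀' : ((R₀ : ℕ) : ℤ) = 32 * (κ : ℤ) + 1 := by rw [hR₀def]; push_cast; ring
          refine ⟨z 1, ⟨by omega, by omega⟩, ?_, ?_, ?_, ?_⟩ <;> omega
      intro x' y' hx hy' heq
      obtain ⟨tO, hto, hv⟩ := boxOf 0 D₁ x' hx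
      obtain ⟨tC, htc, hw⟩ := boxOf 1 D₂ y' hy'
      exact rot_intTipBox_ne hκ1 hto htc hv hw (hi 0) (hi 1) h01 heq
    let X : IntCrossData m N' k₀ K T T' T T' R₀ (rotConfig (i 0) χ) (rotConfig (i 1) χ) :=
      { D₁ := D₁
        D₂ := D₂
        φ₁ := triRotIsoPow (i 0)
        φ₂ := triRotIsoPow (i 1)
        arm0 := fun v => by
          rw [hD₁A0, hsuppW 0 (i 0) (hi 0).le, hD₂A1, hsuppW 0 (i 1) (hi 1).le, RelIso.apply_symm_apply]
        arm1 := fun v => by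
          rw [hD₁A1, hsuppW 1 (i 0) (hi 0).le, hD₂A0, hsuppW 1 (i 1) (hi 1).le, RelIso.apply_symm_apply]
        start0 := by
          rw [hD₁a0, hD₂a1, ← triRotIsoPow_add_apply, show 6 - i 0 + i 0 = 6 by have := hi 0; omega, triRotIsoPow_six_apply,
            ← triRotIsoPow_add_apply, show 6 - i 1 + i 1 = 6 by have := hi 1; omega, triRotIsoPow_six_apply]
        start1 := by
          rw [hD₁a1, hD₂a0, ← triRotIsoPow_add_apply, show 6 - i 0 + i 0 = 6 by have := hi 0; omega, triRotIsoPow_six_apply,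
            ← triRotIsoPow_add_apply, show 6 - i 1 + i 1 = 6 by have := hi 1; omega, triRotIsoPow_six_apply]
        fence_far := fence_far }
    obtain ⟨q, F, F', S, S', up, up', tt, tt', hFa, hFa', hFz, hFz', hmid, hmid', hprot, hprot', hPF, hPF', hSF, hSF', htF, htF', hdj,
      hpr, hpr'⟩ := X.exists_exits_of_rot_prov (hi 0) (hi 1) h01 (fun _ => rfl) (fun _ => rfl)
    -- far provenance: a far actual route site is an actual arm site
    have farB : ∀ w ∈ X.B𝔅 ∪ X.FF𝔉, 2 * (m : ℤ) + 1 < triNorm w → w ∈ (W 0).support ∨ w ∈ (W 1).support := by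
      intro w hw hwn
      have fenceN : ∀ (q : Fin 2) (D : IntPairDataB m N' k₀ K T T' R₀ (rotConfig (i q) χ)) (y : Site 2), y ∈ D.FFB → triNorm y ≤ 2 * (m : ℤ) + 1 := by
        rintro q D y (⟨u, c, z, hu, hy⟩ | ⟨u, d, z, hu, hy⟩)
        · have hb := intFenceSet_box ((D.fence hu).F_subset hy)
          obtain ⟨hz0, hz1, hz2⟩ := tip_isIntJ' hu
          have hk := D.kOf_lt hu
          exact (triNorm_le_iff_lin (x := y)).2 ⟨by omega, by omega, by omega, by omega, by omega, by omega⟩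
        · have hb := intFenceSetUp_box ((D.fenceUp hu).F_subset hy)
          obtain ⟨hz0, hz1, hz2⟩ := IntPairDataB.tipUp_isIntJ hu
          have hk := D.kOfUp_lt hu
          exact (triNorm_le_iff_lin (x := y)).2 ⟨by omega, by omega, by omega, by omega, by omega, by omega⟩
      have termN : ∀ (q : Fin 2) (x : Site 2),
          ((∃ (u : ℕ) (c : Finset (Site 2)) (z : Site 2) (_ : (intDom m).lowestSeq (rotConfig (i q) χ) u = some (c, z)), x ∈ c) ∨
            ∃ (u : ℕ) (d : Finset (Site 2)) (z : Site 2) (_ : (intDom m).flip.lowestSeq (rotConfig (i q) χ) u = some (d, z)), x ∈ d) →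
          triNorm x ≤ 2 * (m : ℤ) := by
        rintro q x (⟨u, c, z, hu, hx⟩ | ⟨u, d, z, hu, hx⟩)
        · exact (term_norm hu hx).2
        · exact (mem_haFin.1 ((IntPairDataB.termUp_isCrossing hu).subset hx)).2.2
      rcases hw with hw | (⟨y, hy, rfl⟩ | ⟨y, hy, rfl⟩)
      · rcases X.mem_B𝔅 hw with ⟨x, hx, rfl⟩ | ⟨x, hx, rfl⟩
        · rcases hx with ⟨sx, hs⟩ | hx
          · fin_cases sx
            · exact Or.inl ((hsuppW 0 (i 0) (hi 0).le x).1 ((hD₁A0 x).1 hs))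
            · exact Or.inr ((hsuppW 1 (i 0) (hi 0).le x).1 ((hD₁A1 x).1 hs))
          · have := termN 0 x hx
            rw [show X.φ₁ x = triRotIsoPow (i 0) x from rfl, triNorm_triRotIsoPow] at hwn; omega
        · rcases hx with ⟨sx, hs⟩ | hx
          · fin_cases sx
            · exact Or.inr ((hsuppW 1 (i 1) (hi 1).le x).1 ((hD₂A0 x).1 hs))
            · exact Or.inl ((hsuppW 0 (i 1) (hi 1).le x).1 ((hD₂A1 x).1 hs))
          · have := termN 1 x hx
            rw [show X.φ₂ x = triRotIsoPow (i 1) x from rfl, triNorm_triRotIsoPow] at hwn; omega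
      · have := fenceN 0 X.D₁ y hy
        rw [show X.φ₁ y = triRotIsoPow (i 0) y from rfl, triNorm_triRotIsoPow] at hwn; omega
      · have := fenceN 1 X.D₂ y hy
        rw [show X.φ₂ y = triRotIsoPow (i 1) y from rfl, triNorm_triRotIsoPow] at hwn; omega
    refine ⟨fun s => if s = 0 then q else 1 - q, F, F', S, S', up, up', tt, tt', ?_, ?_, ?_, hFz, hFz', hmid, hmid', hprot, hprot',
      hPF, hPF', hSF, hSF', htF, htF', hdj, fun h => absurd h h01,
      fun v hv hvn => farB _ (hpr ⟨v, hv, rfl⟩) (by rwa [triNorm_triRotIsoPow]),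
      fun v hv hvn => farB _ (hpr' ⟨v, hv, rfl⟩) (by rwa [triNorm_triRotIsoPow])⟩
    · fin_cases q <;> decide
    · rw [hFa]; show X.D₁.b q = _; simp only [if_true]
      fin_cases q
      · exact hD₁a0
      · exact hD₁a1
    · rw [hFa']; show X.D₂.b q = _; simp only [show (1 : Fin 2) ≠ 0 by decide, if_false]
      fin_cases q
      · exact hD₂a0
      · exact hD₂a1

end Literature.Probability.Percolation
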